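/-
Copyright: statement-level skeleton of a published paper (lit-balaban cell, Phase-2 proof seat p25, gen 16). No proof
claims beyond what the kernel checks below.
-/
import Literature.MathematicalPhysics.QuantumFieldTheory.BalabanImbrieJaffe1984to88.BIJ88Resummation312
import Literature.MathematicalPhysics.QuantumFieldTheory.BalabanImbrieJaffe1984to88.BIJ88VertexComponentsFieldLaw312
import Literature.Probability.LatticeModels.HardCoreUrsell

/-!
# `BalabanImbrieJaffe1984to88.BIJ88Resummation312Display` — T. Bałaban, J. Imbrie, A. Jaffe, *Effective action and
cluster properties of the abelian Higgs model*, Commun. Math. Phys. **114** (1988) 257–315 [BalabanImbrieJaffe1988],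
§5.14 p. 312 [PDF 56] *"Summing all possible diagrams in X_c gives the observable for the next step there,
F^L_{k+1,loc}(X_c). Summing all terms in X_r gives an observable F_{k,rem}(X_r). Then the result of the integration by
parts is ⟨Π_{σ_i} F^{m̄}_{k,loc}(X_{σ_i})⟩ = Σ_{{X_r}} Π_{c: X_c ⊄ ∪_r X_r} F^L_{k+1,loc}(X_c) ⟨Π_r F_{k,rem}(X_r)⟩"* — **THE
FIRST DISPLAY OF p. 312 DERIVED AT EVERY ORDER IN THE INTERACTION** (contraction-graph components), from the
resummation `expand_resum` of the sibling `BIJ88Resummation312`: the Gaussian integral of the product of all the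
observables' legs against `χe^{−V}dμ_{C,ℱ}` equals the sum over the remainder-observable sets `O` and over the
constant-component structures `π` (set partitions of the other observables) of `(Π_{X_c ∈ π} F^L(X_c)) · remv(O)`,
every `F^L(X_c)` (`flBlock`) being the sum of the connected constant diagrams on `X_c` alone and `remv(O)` the
remainder observable of `O` alone under the integral.

statement-level skeleton of published theorems with citation tags; proofs where landed; nothing here is a claim
about the Yang–Mills mass gap

PDF held: `paper:balaban1988-cmp114-bij-abelian-higgs-effective-action` (journal page = PDF page + 256); p. 312 = PDF 56
(`p0056.txt` L1–9 re-read this session).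

CITATION HEADER (lean-in-tree rule).  lit-balaban cell (HOME `run/shared/lean/pub/lit-balaban/`), Phase 2, seat p25
gen 16; row **C2.Claim@312** of `HOME/lit-balaban-r16/ROWS-C2-part2.md` (owner r16, referee ref-5; head untouched —
honest-scope item (c) "resummation" of p25 gen 15 DONE for contraction-graph components; the analytic estimate of
the remainder components (p. 312 *"appropriate bounds"*) stays the row's open head question).  USED BY NAME, nothing
restated: `BIJ88Resummation312.{cst, fl, remv, cst_eq_sum_fl, expand_resum, min'_eq_of_subset,
sdiff_erase_eq_erase_sdiff}`, `BIJ88LabelledExpansion311.{expand_val_init, gintM_coe}` (this seat and generation),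
`LatticeModels.{setPartitions, sum_setPartitions_eq_sum_block}` (the tree's set partitions and their block
decomposition), `BIJ88VertexIbp311.{lmono, vexp}`, `B2Eq228Conditioning.{weight, source}`, p36's
`BIJ88SlotMomentsGauss308.{fieldLaw, integral_fieldLaw}`, gen 15's `BIJ88VertexComponentsFieldLaw312.{dlist_contDiff_one,
dlist_vexp_bounded}`.

## What is proved (0 `sorry`, standard axioms, no new `Prop` facts; definitions with bodies: `flBlock`, `labm`)

* **`resummation312`** — `∫ Π_{i∈K}Π_{w∈obs i}Φ(w) · χe^{−V} dμ = Σ_{O ⊆ K} cst(K ∖ O) · remv(O)`;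
* `flBlock` (`F^L` of a block: the run of its least observable absorbing exactly the others, all legs contracted, no
  `χ′`, fewer than `m̄+1` vertices), **`cst_eq_sum_setPartitions`** (`cst C = Σ_{π ∈ setPartitions C} Π_{P∈π} flBlock P`);
* **`resummation312_components`** — THE DISPLAY IN PRINT'S SHAPE:
  `∫ ΠΦ · χe^{−V} dμ = Σ_{O ⊆ K} Σ_{π ∈ setPartitions (K ∖ O)} (Π_{X_c ∈ π} flBlock X_c) · remv(O)`;
* `resummation312_normalized` (divided by `Z = ∫χe^{−V}dμ`: the remainder part as a normalized expectation);
  `remv_empty` (`remv ∅ = Z`), `cst_empty`, `resummation312_normalized_leading` (the `O = ∅` term is `cst K`: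
  `⟨ΠF⟩ = cst K + Σ_{∅≠O⊆K} cst(K∖O)·remv(O)/Z`);
* §4b what `X_c`, `X_r ⊆ K` are: def `labm` (label multiset of a state), `run_labm` (a run neither loses nor
  duplicates an observable), **`expand_labm`**, **`expand_labels_partition`** (for every term of `expand 0 K` the
  label sets of its constant components and of its remainder components are pairwise disjoint and add up to `K`);
* §5 on p36's law of the fields of `W`: `gintM_eq_integral`, **`resummation312_fieldLaw`**,
  **`resummation312_display_fieldLaw`** (normalized by `⟨χe^{−V}⟩`; cutoff hypotheses discharged for smooth compactly
  supported `χ` by gen 15's `dlist_contDiff_one` / `dlist_vexp_bounded`).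
HONEST SCOPE: as in `BIJ88Resummation312` — contraction-graph components with one covariance, a fixed order of
events, observables taken up in the order of `κ`; `remv(O)` one block; no estimates.  CURRENCY (asked by the row
owner r16): this file feeds NONE of `BIJ88Sect5StatementsPart4.Ineq312`, `hobs`, `RemainderComponent` by name — no
declaration of `BIJ88Sect5StatementsPart4` is referenced (that module sits in the transitive import closure of
`BIJ88VertexComponentsFieldLaw312` only); the displays conclude on the Gaussian integral `∫ … dμ_{C,ℱ}` (§4,
`weight A · source f` against Lebesgue measure, as in `BIJ88VertexIbp311`) and on the §5.13 law of the fields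
`BIJ88SlotMomentsGauss308.fieldLaw blk Δ ℱ W` (§5), with `cst`/`flBlock`/`remv` of the labelled expansion as the
right-hand currency; the p. 312 ESTIMATE (second display) is not addressed and the head `Ineq312` (typed at print's
ceiling) is untouched.  NOT summit progress; NOT continuum; NOT Clay.  Imports `BIJ88Resummation312`, `BIJ88VertexComponentsFieldLaw312` (cutoff lemmas, `fieldLaw`),
`LatticeModels.HardCoreUrsell`; modifies nothing.
-/

noncomputable section

namespace Literature.MathematicalPhysics.QuantumFieldTheory.BalabanImbrieJaffe1984to88.BIJ88Resummation312Display

open Classical MeasureTheory Matrix Finset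
open scoped BigOperators
open Literature.MathematicalPhysics.QuantumFieldTheory.Balaban1983to89
open B2Eq228Conditioning (weight source)
open BIJ88VertexIbp311 (lmono vexp)
open BIJ88WickDerivatives305 (dlist)
open BIJ88VertexComponents311 (Grp maxArity)
open BIJ88LabelledRun311 BIJ88LabelledRunEnv311 BIJ88LabelledExpansion311 BIJ88Resummation312
open Literature.Probability.LatticeModels (setPartitions mem_setPartitions setPartitions_empty
  sum_setPartitions_eq_sum_block IsSetPartition)
open BIJ88PolymerRep5134 (corner)
open BIJ88PolymerRep5134Gauss (prec src)
open BIJ88SlotMomentsGauss308 (fieldLaw integral_fieldLaw)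
open BIJ88VertexComponentsFieldLaw312 (dlist_contDiff_one dlist_vexp_bounded)
open scoped ContDiff

variable {S : Type} [Fintype S] [DecidableEq S] {ι : Type} [Fintype ι] {κ : Type} [LinearOrder κ]
variable {A : Matrix S S ℝ} {f : S → ℝ} {c : ι → ℝ} {legs : ι → List (S → ℝ)} {obs : κ → List (S → ℝ)} {M : ℕ}
  {χ : (S → ℝ) → ℝ}

/-! ## §4  The display -/

/-- **p. 312, FIRST DISPLAY, AT EVERY ORDER IN THE INTERACTION** (contraction-graph components): for observables `K`
with leg lists `obs`, in the Gaussian measure `dμ_{C,ℱ}` with weight `χe^{−V}` (`A = C⁻¹` positive definite, every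
`(Π∂)χ` of class `C¹` with `(Π∂)χ·e^{−V}` bounded):
`∫ Π_{i∈K}Π_{w∈obs i}Φ(w) · χe^{−V} dμ = Σ_{O ⊆ K} cst(K ∖ O) · remv(O)` — *"Σ_{{X_r}} Π_c F^L_{k+1,loc}(X_c)
⟨Π_r F_{k,rem}(X_r)⟩"* before normalization: the observables in remainder components (`O`) and the constant
components of the others (`cst`, organised component by component by `cst_eq_sum_fl`).
[cite: BalabanImbrieJaffe1988, §5.14 p.312] -/
theorem resummation312 (hA : A.PosDef) (hχ : ∀ D : List (S → ℝ), ContDiff ℝ 1 (dlist D χ))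
    (h0 : ∀ D : List (S → ℝ), ∃ K, ∀ φ, ‖dlist D χ φ * vexp c legs φ‖ ≤ K) (K : Finset κ) :
    ∫ φ : S → ℝ, lmono (K.val.toList.flatMap obs) φ * (χ φ * vexp c legs φ) * (weight A φ * source f φ)
      = ∑ O ∈ K.powerset, cst A f c legs obs M (K \ O) * remv A f c legs obs M χ [] 0 O := by
  have h1 := expand_val_init (A := A) (f := f) (c := c) (legs := legs) (χ := χ) (obs := obs) (M := M) hA hχ h0 K
  have h2 := expand_resum (A := A) (f := f) (c := c) (legs := legs) (obs := obs) (M := M) (χ := χ) _ 0 K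
    (Nat.lt_succ_self _) (fun h hh => absurd hh (Multiset.notMem_zero _)) []
  rw [← h2, ← h1]
  have e : (K.val.map fun j => (obs j : Multiset (S → ℝ))).sum = ((K.val.toList.flatMap obs : List (S → ℝ)) : Multiset _) := by
    change Multiset.bind K.val (fun j => (obs j : Multiset (S → ℝ))) = _
    conv_lhs => rw [← Multiset.coe_toList K.val]
    exact Multiset.coe_bind _ _
  rw [e, gintM_coe, BIJ88VertexComponentsExpansion311.gint, dlist]

/-- **THE CONSTANT PART ORGANISED INTO CONSTANT COMPONENTS** (*"{X_c} determined once the remainder components are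
specified … Summing all possible diagrams in X_c gives F^L_{k+1,loc}(X_c)"*): for `C` non-empty with least observable
`i` and `E = C ∖ i`, `cst C = Σ_{O ⊆ E} fl(i, E ∖ O) · cst O` — the component of `i` is ONE constant component
`F^L` on `{i} ∪ (E ∖ O)`, the observables `O` organise into constant components on their own; unfolding the
recursion, `cst C` is the sum over the set partitions of `C` of the products of the `fl` of the blocks.
[cite: BalabanImbrieJaffe1988, §5.14 p.312] -/
theorem cst_eq_sum_fl {C : Finset κ} (h : C.Nonempty) :
    cst A f c legs obs M C
      = ∑ O ∈ (C.erase (C.min' h)).powerset,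
          fl A f c legs obs M (C.min' h) (C.erase (C.min' h) \ O) * cst A f c legs obs M O := by
  set E := C.erase (C.min' h) with hE
  set X := (run A f c legs obs M (pristine obs (C.min' h)) E 0).filter fun o => o.g.IsConst M with hX
  rw [cst_step h, ← hE]
  -- group the constant outcomes by the observables they leave untouched
  rw [sum_map_fiber (fun o : Outcome S κ => o.rest) (fun o => o.a * cst A f c legs obs M o.rest) E.powerset X
    (fun o ho => Finset.mem_powerset.2 (run_rest_subset _ _ _ o (Multiset.mem_of_mem_filter ho)))]
  refine Finset.sum_congr rfl fun O hO => ?_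
  have hO' := Finset.mem_powerset.1 hO
  -- on the fibre `o.rest = O` the weight is `a_o · cst O`
  have e1 : ((X.filter fun o => o.rest = O).map fun o => o.a * cst A f c legs obs M o.rest).sum
      = ((X.filter fun o => o.rest = O).map fun o => o.a).sum * cst A f c legs obs M O := by
    rw [← Multiset.sum_map_mul_right]
    refine congrArg _ (Multiset.map_congr rfl fun o ho => ?_)
    rw [(Multiset.mem_filter.1 ho).2]
  rw [e1]
  congr 1
  -- the fibre is the set of constant runs in the environment `E ∖ O` that absorb all of it (environment lemma I)
  rw [fl, hX, Multiset.filter_filter]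
  have e2 : (run A f c legs obs M (pristine obs (C.min' h)) E 0).filter (fun o => o.rest = O ∧ o.g.IsConst M)
      = ((run A f c legs obs M (pristine obs (C.min' h)) E 0).filter fun o => E \ (E \ O) ⊆ o.rest).filter
          fun o => o.g.IsConst M ∧ o.rest = O := by
    rw [Multiset.filter_filter]
    refine Multiset.filter_congr fun o _ => ?_
    rw [Finset.sdiff_sdiff_eq_self hO']
    constructor
    · rintro ⟨h1, h2⟩; exact ⟨⟨h2, h1⟩, h1.ge⟩
    · rintro ⟨⟨h2, h1⟩, _⟩; exact ⟨h1, h2⟩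
  rw [e2, run_filter_env _ _ _ _ (Nat.lt_succ_self _) (E \ O) Finset.sdiff_subset, Multiset.filter_map,
    Multiset.map_map]
  have e3 : ((run A f c legs obs M (pristine obs (C.min' h)) (E \ O) 0).filter
        ((fun o => o.g.IsConst M ∧ o.rest = O) ∘ fun o : Outcome S κ => { o with rest := o.rest ∪ (E \ (E \ O)) }))
      = (run A f c legs obs M (pristine obs (C.min' h)) (E \ O) 0).filter fun o => o.g.IsConst M ∧ o.rest = ∅ := by
    refine Multiset.filter_congr fun o ho => ?_
    have hr : o.rest ⊆ E \ O := run_rest_subset _ _ _ o ho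
    have hd : Disjoint o.rest O := Finset.disjoint_of_subset_left hr Finset.sdiff_disjoint
    simp only [Function.comp_apply, Finset.sdiff_sdiff_eq_self hO']
    constructor
    · rintro ⟨h1, h2⟩
      refine ⟨h1, Finset.eq_empty_of_forall_notMem fun x hx => ?_⟩
      have hxO : x ∈ O := h2 ▸ Finset.mem_union_left _ hx
      exact Finset.disjoint_left.1 hd hx hxO
    · rintro ⟨h1, h2⟩
      exact ⟨h1, by rw [h2, Finset.empty_union]⟩
  rw [e3]
  rfl

/-- **`F^L` of a block**: for a non-empty set `P` of observables, the constant component in which the least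
observable of `P` absorbs exactly the others (all connected constant diagrams on `P`); `1` on the empty block (which
never occurs). [cite: BalabanImbrieJaffe1988, §5.14 p.312] -/
def flBlock (A : Matrix S S ℝ) (f : S → ℝ) (c : ι → ℝ) (legs : ι → List (S → ℝ)) (obs : κ → List (S → ℝ)) (M : ℕ)
    (P : Finset κ) : ℝ :=
  if h : P.Nonempty then fl A f c legs obs M (P.min' h) (P.erase (P.min' h)) else 1

/-- **`Σ_{{X_c}} Π_c F^L(X_c)` — THE CONSTANT PART IS THE SUM OVER THE CONSTANT-COMPONENT STRUCTURES OF THE PRODUCT OF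
THE COMPONENTS' `F^L`** (*"Summing all possible diagrams in X_c gives the observable for the next step there,
F^L_{k+1,loc}(X_c)"*): `cst C = Σ_{π ∈ setPartitions C} Π_{P ∈ π} flBlock P`, unfolding `cst_eq_sum_fl` along the
block of the least observable (`LatticeModels.sum_setPartitions_eq_sum_block`). [cite: BalabanImbrieJaffe1988, §5.14 p.312] -/
theorem cst_eq_sum_setPartitions : ∀ (n : ℕ) (C : Finset κ), C.card < n →
    cst A f c legs obs M C = ∑ π ∈ setPartitions C, ∏ P ∈ π, flBlock A f c legs obs M P
  | 0, _, hn => absurd hn (Nat.not_lt_zero _)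
  | n + 1, C, hn => by
    by_cases h : C.Nonempty
    swap
    · rw [Finset.not_nonempty_iff_eq_empty.1 h, setPartitions_empty, Finset.sum_singleton, Finset.prod_empty, cst,
        expand_of_not_nonempty A f c legs obs M Finset.not_nonempty_empty, Multiset.filter_singleton, if_pos rfl]
      simp
    have hi := C.min'_mem h
    rw [cst_eq_sum_fl h, sum_setPartitions_eq_sum_block hi]
    -- the block `P₀ ∋ min C` ↔ the untouched observables `O = C ∖ P₀`
    refine Finset.sum_nbij' (fun O => C \ O) (fun P₀ => C \ P₀) ?_ ?_ ?_ ?_ ?_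
    · intro O hO
      have hO := Finset.mem_powerset.1 hO
      refine Finset.mem_filter.2 ⟨Finset.mem_powerset.2 Finset.sdiff_subset, Finset.mem_sdiff.2 ⟨hi, fun h' => ?_⟩⟩
      exact Finset.notMem_erase _ _ (hO h')
    · intro P₀ hP₀
      obtain ⟨-, hiP⟩ := Finset.mem_filter.1 hP₀
      refine Finset.mem_powerset.2 fun x hx => Finset.mem_erase.2 ⟨?_, (Finset.mem_sdiff.1 hx).1⟩
      rintro rfl
      exact (Finset.mem_sdiff.1 hx).2 hiP
    · intro O hO
      exact Finset.sdiff_sdiff_eq_self ((Finset.mem_powerset.1 hO).trans (Finset.erase_subset _ _))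
    · intro P₀ hP₀
      exact Finset.sdiff_sdiff_eq_self (Finset.mem_powerset.1 (Finset.mem_filter.1 hP₀).1)
    · intro O hO
      have hO' := (Finset.mem_powerset.1 hO).trans (Finset.erase_subset _ _)
      have hiO : C.min' h ∈ C \ O :=
        Finset.mem_sdiff.2 ⟨hi, fun h' => Finset.notMem_erase _ _ (Finset.mem_powerset.1 hO h')⟩
      have hne : (C \ O).Nonempty := ⟨_, hiO⟩
      have hmin : (C \ O).min' hne = C.min' h := min'_eq_of_subset h Finset.sdiff_subset hiO
      have hcard : (C \ (C \ O)).card < n := by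
        rw [Finset.sdiff_sdiff_eq_self hO']
        exact lt_of_lt_of_le (lt_of_le_of_lt (Finset.card_le_card (Finset.mem_powerset.1 hO))
          (Finset.card_erase_lt_of_mem hi)) (Nat.lt_succ_iff.1 hn)
      -- `P₀ ∉ κ`, so the product over `insert P₀ κ` splits off `flBlock P₀`
      have e : ∀ π ∈ setPartitions (C \ (C \ O)), ∏ P ∈ insert (C \ O) π, flBlock A f c legs obs M P
          = flBlock A f c legs obs M (C \ O) * ∏ P ∈ π, flBlock A f c legs obs M P := fun π hπ =>
        Finset.prod_insert ((mem_setPartitions.1 hπ).notMem_of_sdiff hne)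
      rw [Finset.sum_congr rfl e, ← Finset.mul_sum, ← cst_eq_sum_setPartitions n _ hcard,
        Finset.sdiff_sdiff_eq_self hO', flBlock, dif_pos hne, hmin, sdiff_erase_eq_erase_sdiff]

/-- **p. 312, FIRST DISPLAY, IN PRINT'S SHAPE** `Σ_{{X_r}} Π_{c} F^L_{k+1,loc}(X_c) ⟨Π_r F_{k,rem}(X_r)⟩` (before
normalization, contraction-graph components): the integral of the product of all observables' legs against
`χe^{−V}dμ_{C,ℱ}` is the sum over the remainder-observable sets `O ⊆ K` and the constant-component structures `π`
of `K ∖ O` of `(Π_{X_c ∈ π} flBlock X_c) · remv(O)`. [cite: BalabanImbrieJaffe1988, §5.14 p.312] -/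
theorem resummation312_components (hA : A.PosDef) (hχ : ∀ D : List (S → ℝ), ContDiff ℝ 1 (dlist D χ))
    (h0 : ∀ D : List (S → ℝ), ∃ K, ∀ φ, ‖dlist D χ φ * vexp c legs φ‖ ≤ K) (K : Finset κ) :
    ∫ φ : S → ℝ, lmono (K.val.toList.flatMap obs) φ * (χ φ * vexp c legs φ) * (weight A φ * source f φ)
      = ∑ O ∈ K.powerset, ∑ π ∈ setPartitions (K \ O),
          (∏ Xc ∈ π, flBlock A f c legs obs M Xc) * remv A f c legs obs M χ [] 0 O := by
  rw [resummation312 (M := M) hA hχ h0 K]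
  refine Finset.sum_congr rfl fun O _ => ?_
  rw [cst_eq_sum_setPartitions _ _ (Nat.lt_succ_self _), Finset.sum_mul]

/-- **p. 312, FIRST DISPLAY, NORMALIZED**: with `Z = ∫ χe^{−V} dμ ≠ 0`,
`⟨Π_i F_{k,loc}(X_{σ_i})⟩ := (∫ Π Φ · χe^{−V} dμ)/Z = Σ_{O ⊆ K} cst(K ∖ O) · (remv(O)/Z)` — the constant components are
field-independent numbers, the remainder part is a normalized expectation. [cite: BalabanImbrieJaffe1988, §5.14 p.312] -/
theorem resummation312_normalized (hA : A.PosDef) (hχ : ∀ D : List (S → ℝ), ContDiff ℝ 1 (dlist D χ))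
    (h0 : ∀ D : List (S → ℝ), ∃ K, ∀ φ, ‖dlist D χ φ * vexp c legs φ‖ ≤ K) (K : Finset κ) (Z : ℝ) :
    (∫ φ : S → ℝ, lmono (K.val.toList.flatMap obs) φ * (χ φ * vexp c legs φ) * (weight A φ * source f φ)) / Z
      = ∑ O ∈ K.powerset, cst A f c legs obs M (K \ O) * (remv A f c legs obs M χ [] 0 O / Z) := by
  rw [resummation312 (M := M) hA hχ h0 K, Finset.sum_div]
  refine Finset.sum_congr rfl fun O _ => ?_
  ring

/-- **The term with no remainder component**: `remv` of no observable (nothing set aside, no direction) is the bare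
normalization `Z = ∫ χe^{−V} dμ_{C,ℱ}` — so in the normalized display the `O = ∅` term is `cst K`
(`resummation312_normalized_leading`), print's term in which every component is constant.
[cite: BalabanImbrieJaffe1988, §5.14 p.312] -/
theorem remv_empty (A : Matrix S S ℝ) (f : S → ℝ) (c : ι → ℝ) (legs : ι → List (S → ℝ)) (obs : κ → List (S → ℝ))
    (M : ℕ) (χ : (S → ℝ) → ℝ) :
    remv A f c legs obs M χ [] 0 (∅ : Finset κ) = ∫ φ : S → ℝ, χ φ * vexp c legs φ * (weight A φ * source f φ) := by
  rw [remv, expand_of_not_nonempty A f c legs obs M Finset.not_nonempty_empty, Multiset.filter_singleton,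
    if_pos rfl, Multiset.map_singleton, Multiset.sum_singleton, tval, one_mul, Multiset.map_zero, Multiset.sum_zero,
    List.nil_append, ← Multiset.coe_nil, gintM_coe, BIJ88VertexComponentsExpansion311.gint]
  refine integral_congr_ae (Filter.Eventually.of_forall fun φ => ?_)
  simp only [BIJ88VertexIbp311.lmono_nil, BIJ88WickDerivatives305.dlist_nil, one_mul]

/-- `cst ∅ = 1`: no observable, no constant component, the empty product. [cite: BalabanImbrieJaffe1988, §5.14 p.312] -/
theorem cst_empty (A : Matrix S S ℝ) (f : S → ℝ) (c : ι → ℝ) (legs : ι → List (S → ℝ)) (obs : κ → List (S → ℝ))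
    (M : ℕ) : cst A f c legs obs M (∅ : Finset κ) = 1 := by
  rw [cst, expand_of_not_nonempty A f c legs obs M Finset.not_nonempty_empty, Multiset.filter_singleton, if_pos rfl,
    Multiset.map_singleton, Multiset.sum_singleton]

/-- **The normalized display with the all-constant term separated**: with `Z = ∫ χe^{−V} dμ ≠ 0`,
`⟨Π_i F_{k,loc}(X_{σ_i})⟩ = cst K + Σ_{∅ ≠ O ⊆ K} cst(K ∖ O) · (remv(O)/Z)` — the leading term has every component
constant (`cst K = Σ_π Π_c F^L(X_c)` by `cst_eq_sum_setPartitions`), every other term carries at least one remainder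
component under a normalized expectation. [cite: BalabanImbrieJaffe1988, §5.14 p.312] -/
theorem resummation312_normalized_leading (hA : A.PosDef) (hχ : ∀ D : List (S → ℝ), ContDiff ℝ 1 (dlist D χ))
    (h0 : ∀ D : List (S → ℝ), ∃ K, ∀ φ, ‖dlist D χ φ * vexp c legs φ‖ ≤ K) (K : Finset κ)
    (hZ : ∫ φ : S → ℝ, χ φ * vexp c legs φ * (weight A φ * source f φ) ≠ 0) :
    (∫ φ : S → ℝ, lmono (K.val.toList.flatMap obs) φ * (χ φ * vexp c legs φ) * (weight A φ * source f φ))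
        / ∫ φ : S → ℝ, χ φ * vexp c legs φ * (weight A φ * source f φ)
      = cst A f c legs obs M K
        + ∑ O ∈ K.powerset.erase ∅, cst A f c legs obs M (K \ O) * (remv A f c legs obs M χ [] 0 O
            / ∫ φ : S → ℝ, χ φ * vexp c legs φ * (weight A φ * source f φ)) := by
  rw [resummation312_normalized (M := M) hA hχ h0 K, ← Finset.add_sum_erase _ _ (Finset.empty_mem_powerset K),
    Finset.sdiff_empty, remv_empty, div_self hZ, mul_one]

/-! ## §4b  The blocks of a term partition the observables (what `X_c`, `X_r` ⊆ `K` are) -/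

section Labels

/-- **Label bookkeeping of a state**: the observables in the running component, in the environment and in the
set-aside components, as ONE multiset. [cite: BalabanImbrieJaffe1988, §5.14 p.311–312] -/
def labm (g : LGrp S κ) (rest : Finset κ) (done : Multiset (LGrp S κ)) : Multiset κ :=
  g.lab.val + rest.val + (done.map fun h => h.lab.val).sum

/-- **A run moves observables between the environment, the set-aside components and the running component without
loss or duplication**: if no observable occurs twice in a state, every outcome of its run has the same label
multiset. [cite: BalabanImbrieJaffe1988, §5.14 p.311–312] -/
theorem run_labm (A : Matrix S S ℝ) (f : S → ℝ) (c : ι → ℝ) (legs : ι → List (S → ℝ)) (obs : κ → List (S → ℝ))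
    (M : ℕ) (g : LGrp S κ) (rest : Finset κ) (done : Multiset (LGrp S κ)) :
    ∀ o ∈ run A f c legs obs M g rest done, (labm g rest done).Nodup → labm o.g o.rest o.done = labm g rest done := by
  refine run_ind' (P := fun g rest done o => (labm g rest done).Nodup → labm o.g o.rest o.done = labm g rest done)
    (fun _ _ _ _ _ => rfl) ?_ ?_ ?_ ?_ ?_ ?_ g rest done
  · intro g rest done u L _ _ i o _ h hn
    rw [Outcome.scale_g, Outcome.scale_done, Outcome.scale_rest]
    exact h hn
  · intro g rest done u L _ _ j hj i o _ h hn
    rw [Outcome.scale_g, Outcome.scale_done, Outcome.scale_rest]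
    have hd : j ∉ g.lab := fun hj' =>
      Multiset.disjoint_left.1 (Multiset.nodup_add.1 (Multiset.nodup_add.1 hn).1).2.2 hj' hj
    have e : labm (⟨⟨L ++ (obs j).eraseIdx i, g.nchi, g.nv⟩, g.lab ∪ {j}⟩ : LGrp S κ) (rest.erase j) done
        = labm g rest done := by
      simp only [labm]
      rw [Finset.union_comm, ← Finset.insert_eq, Finset.insert_val_of_notMem hd, Finset.erase_val,
        Multiset.cons_add, ← Multiset.add_cons, Multiset.cons_erase (Finset.mem_def.1 hj)]
    rw [e] at h
    exact h hn
  · intro g rest done u L _ _ h hh i _ o _ h' hn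
    rw [Outcome.scale_g, Outcome.scale_done, Outcome.scale_rest]
    have hsplit : (done.map fun h => h.lab.val).sum = h.lab.val + ((done.erase h).map fun h => h.lab.val).sum := by
      conv_lhs => rw [← Multiset.cons_erase hh]
      rw [Multiset.map_cons, Multiset.sum_cons]
    have hd : Disjoint g.lab h.lab := by
      rw [labm, hsplit] at hn
      exact Finset.disjoint_val.1 (Multiset.disjoint_add_right.1
        (Multiset.disjoint_add_left.1 (Multiset.nodup_add.1 hn).2.2).1).1
    have e : labm (LGrp.absorb L g h i) rest (done.erase h) = labm g rest done := by
      simp only [labm, LGrp.absorb]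
      rw [hsplit, ← Finset.disjUnion_eq_union _ _ hd]
      show g.lab.val + h.lab.val + rest.val + _ = _
      simp only [add_assoc, add_left_comm, add_comm]
    rw [e] at h'
    exact h' hn
  · intro g rest done u L _ _ o _ h hn
    rw [Outcome.scale_g, Outcome.scale_done, Outcome.scale_rest]
    exact h hn
  · intro g rest done u L _ _ o _ h hn
    rw [Outcome.push_g, Outcome.push_done, Outcome.push_rest]
    exact h hn
  · intro g rest done u L _ _ m j o _ h hn
    rw [Outcome.bump_g, Outcome.bump_done, Outcome.bump_rest, Outcome.scale_g, Outcome.scale_done, Outcome.scale_rest]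
    exact h hn

/-- **THE BLOCKS AND THE SET-ASIDE COMPONENTS OF A TERM PARTITION THE OBSERVABLES**: if no observable occurs twice
among `rest` and the labels of `done`, then for every term of `expand done rest` the label multisets of its constant
components and of its set-aside components add up to exactly `rest` plus the labels of `done` — each observable
exactly once.  For the expansion from nothing set aside (`expand 0 K`): the label sets of the blocks `X_c` and of the
remainder components are pairwise disjoint and cover `K` (`expand_labels_partition`).
[cite: BalabanImbrieJaffe1988, §5.14 p.311–312] -/
theorem expand_labm (A : Matrix S S ℝ) (f : S → ℝ) (c : ι → ℝ) (legs : ι → List (S → ℝ)) (obs : κ → List (S → ℝ))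
    (M : ℕ) : ∀ (n : ℕ) (done : Multiset (LGrp S κ)) (rest : Finset κ), rest.card < n →
    (rest.val + (done.map fun h => h.lab.val).sum).Nodup →
    ∀ t ∈ expand A f c legs obs M done rest,
      ((t.consts + t.groups).map fun h => h.lab.val).sum = rest.val + (done.map fun h => h.lab.val).sum
  | 0, _, _, hn => fun _ _ _ => absurd hn (Nat.not_lt_zero _)
  | n + 1, done, rest, hn => by
    intro hnd t ht
    by_cases h : rest.Nonempty
    · rw [expand_of_nonempty A f c legs obs M h, mem_mbind] at ht
      obtain ⟨o, ho, ht⟩ := ht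
      have hcard : o.rest.card < n := lt_of_lt_of_le (lt_of_le_of_lt (Finset.card_le_card (run_rest_subset _ _ _ o ho))
        (Finset.card_erase_lt_of_mem (rest.min'_mem h))) (Nat.lt_succ_iff.1 hn)
      have e0 : labm (pristine obs (rest.min' h)) (rest.erase (rest.min' h)) done
          = rest.val + (done.map fun h => h.lab.val).sum := by
        simp only [labm, pristine]
        rw [Finset.erase_val, Finset.singleton_val, Multiset.singleton_add, Multiset.cons_erase
          (Finset.mem_def.1 (rest.min'_mem h))]
      have hl := run_labm A f c legs obs M _ _ _ o ho (e0 ▸ hnd)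
      rw [e0] at hl
      split_ifs at ht with hg
      · rw [Multiset.mem_map] at ht
        obtain ⟨t', ht', rfl⟩ := ht
        have hnd' : (o.rest.val + (o.done.map fun h => h.lab.val).sum).Nodup := by
          refine Multiset.nodup_of_le ?_ (hl ▸ hnd : (labm o.g o.rest o.done).Nodup)
          rw [labm, add_assoc]
          exact Multiset.le_add_left _ _
        have ih := expand_labm A f c legs obs M n o.done o.rest hcard hnd' t' ht'
        rw [RTerm.addConst_consts, oact_consts, RTerm.addConst_groups, oact_groups, Multiset.cons_add,
          Multiset.map_cons, Multiset.sum_cons, ih, ← hl, labm, add_assoc]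
      · rw [Multiset.mem_map] at ht
        obtain ⟨t', ht', rfl⟩ := ht
        have e1 : o.rest.val + ((o.g ::ₘ o.done).map fun h => h.lab.val).sum = labm o.g o.rest o.done := by
          rw [Multiset.map_cons, Multiset.sum_cons, labm]
          abel
        have hnd' : (o.rest.val + ((o.g ::ₘ o.done).map fun h => h.lab.val).sum).Nodup := by
          rw [e1, hl]; exact hnd
        have ih := expand_labm A f c legs obs M n (o.g ::ₘ o.done) o.rest hcard hnd' t' ht'
        rw [oact_consts, oact_groups, ih, e1, hl]
    · rw [expand_of_not_nonempty A f c legs obs M h, Multiset.mem_singleton] at ht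
      subst ht
      rw [Finset.not_nonempty_iff_eq_empty.1 h, zero_add, Finset.empty_val, zero_add]

/-- **For the expansion of `K` from nothing set aside, the label sets of the constant components `X_c` and of the
remainder components of every term are pairwise disjoint subsets of `K` covering `K`** — the multiset of all their
elements is exactly `K`. [cite: BalabanImbrieJaffe1988, §5.14 p.311–312] -/
theorem expand_labels_partition (A : Matrix S S ℝ) (f : S → ℝ) (c : ι → ℝ) (legs : ι → List (S → ℝ))
    (obs : κ → List (S → ℝ)) (M : ℕ) (K : Finset κ) :
    ∀ t ∈ expand A f c legs obs M 0 K,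
      ((t.consts + t.groups).map fun h => h.lab.val).sum = K.val
      ∧ (∀ h ∈ t.consts + t.groups, h.lab ⊆ K)
      ∧ ∀ h ∈ t.consts + t.groups, ∀ h' ∈ (t.consts + t.groups).erase h, Disjoint h.lab h'.lab := by
  intro t ht
  have e := expand_labm A f c legs obs M _ 0 K (Nat.lt_succ_self _)
    (by rw [Multiset.map_zero, Multiset.sum_zero, add_zero]; exact K.nodup) t ht
  rw [Multiset.map_zero, Multiset.sum_zero, add_zero] at e
  refine ⟨e, fun h hh x hx => ?_, fun h hh h' hh' => ?_⟩
  · rw [← Finset.mem_def.symm, ← e] -- membership in K.val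
    exact Multiset.mem_of_le (Multiset.le_sum_of_mem (Multiset.mem_map_of_mem _ hh)) hx
  · have hs : ((t.consts + t.groups).map fun h => h.lab.val).sum
        = h.lab.val + (h'.lab.val + ((((t.consts + t.groups).erase h).erase h').map fun h => h.lab.val).sum) := by
      conv_lhs => rw [← Multiset.cons_erase hh, Multiset.map_cons, Multiset.sum_cons, ← Multiset.cons_erase hh',
        Multiset.map_cons, Multiset.sum_cons]
    have hn : (((t.consts + t.groups).map fun g : LGrp S κ => g.lab.val).sum).Nodup := by rw [e]; exact K.nodup
    rw [hs] at hn
    exact Finset.disjoint_val.1 (Multiset.disjoint_add_right.1 (Multiset.nodup_add.1 hn).2.2).1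

end Labels

/-! ## §5 On the law of the fields of `W` (the model of record of §5.13–5.14) -/

section FieldLaw

variable {α' I : Type} [Fintype α'] [DecidableEq α'] [Fintype I] [DecidableEq I]
  (blk : α' → I) (Δ : Matrix α' α' ℝ) (ℱ : α' → ℝ) (W : Finset I)

omit [Fintype S] [DecidableEq S] in
/-- The multiset Gaussian integral as an integral over a list of its legs (bookkeeping). [cite: BalabanImbrieJaffe1988, §5.14 p.312] -/
theorem gintM_eq_integral [Fintype S] (A : Matrix S S ℝ) (f : S → ℝ) (c : ι → ℝ) (legs : ι → List (S → ℝ))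
    (χ : (S → ℝ) → ℝ) (P : Multiset (S → ℝ)) (D : List (S → ℝ)) :
    gintM A f c legs χ P D = ∫ φ, lmono P.toList φ * (dlist D χ φ * vexp c legs φ) * (weight A φ * source f φ) := by
  conv_lhs => rw [← Multiset.coe_toList P]
  rfl

/-- **THE p. 312 FIRST DISPLAY ON THE LAW OF THE FIELDS OF `W`, AT EVERY ORDER IN THE INTERACTION** (contraction-graph
components): for p36's `fieldLaw blk Δ ℱ W` (precision `prec blk Δ W (corner ℝ W)` positive definite, source
`src blk ℱ W`), a smooth compactly supported cutoff `χ`, observables `K` with leg lists `obs`: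
`∫ Π_{i∈K}Π_{w∈obs i}Φ(w)·χe^{−V} dfieldLaw = Σ_{O ⊆ K} Σ_{π ∈ setPartitions (K∖O)} (Π_{X_c∈π} flBlock X_c) ·
Σ_{t ∈ expand 0 O, no block} coef_t ∫ Π_{pending legs of t}Φ·(Π_{dirs_t}∂)χ·e^{−V} dfieldLaw` — the `F^L(X_c)` are
numbers, the remainder part an integral on the law. [cite: BalabanImbrieJaffe1988, §5.14 p.312] -/
theorem resummation312_fieldLaw (hPD : (prec blk Δ W (corner ℝ W)).PosDef) (c : ι → ℝ)
    (legs : ι → List ({x : α' // blk x ∈ W} → ℝ)) {χ : ({x : α' // blk x ∈ W} → ℝ) → ℝ} (hχ : ContDiff ℝ ∞ χ)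
    (hs : HasCompactSupport χ) (M : ℕ) (obs : κ → List ({x : α' // blk x ∈ W} → ℝ)) (K : Finset κ) :
    ∫ φ, lmono (K.val.toList.flatMap obs) φ * (χ φ * vexp c legs φ) ∂(fieldLaw blk Δ ℱ W)
      = ∑ O ∈ K.powerset, ∑ π ∈ setPartitions (K \ O),
          (∏ Xc ∈ π, flBlock (prec blk Δ W (corner ℝ W)) (src blk ℱ W) c legs obs M Xc) *
            (((expand (prec blk Δ W (corner ℝ W)) (src blk ℱ W) c legs obs M 0 O).filter fun t => t.consts = 0).map
              fun t => t.coef * ∫ φ, lmono ((t.groups.map fun h => (h.pend : Multiset _)).sum.toList) φ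
                * (dlist t.dirs χ φ * vexp c legs φ) ∂(fieldLaw blk Δ ℱ W)).sum := by
  rw [integral_fieldLaw, resummation312_components (M := M) (obs := obs) hPD (fun D => dlist_contDiff_one D hχ)
    (dlist_vexp_bounded c legs hχ hs) K, Finset.sum_div]
  refine Finset.sum_congr rfl fun O _ => ?_
  rw [Finset.sum_div]
  refine Finset.sum_congr rfl fun π _ => ?_
  rw [mul_div_assoc, remv, div_eq_mul_inv, ← Multiset.sum_map_mul_right]
  congr 2
  refine Multiset.map_congr rfl fun t _ => ?_
  rw [integral_fieldLaw, tval, gintM_eq_integral, List.nil_append, div_eq_mul_inv, mul_assoc]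

/-- **THE p. 312 FIRST DISPLAY ON THE LAW, NORMALIZED BY `⟨χe^{−V}⟩`**: *"⟨Π_{σ_i}F^{m̄}_{k,loc}(X_{σ_i})⟩ =
Σ_{{X_r}} Π_c F^L_{k+1,loc}(X_c) ⟨Π_r F_{k,rem}(X_r)⟩"* — the constant components are numbers, the remainder part
a normalized expectation. [cite: BalabanImbrieJaffe1988, §5.14 p.312] -/
theorem resummation312_display_fieldLaw (hPD : (prec blk Δ W (corner ℝ W)).PosDef) (c : ι → ℝ)
    (legs : ι → List ({x : α' // blk x ∈ W} → ℝ)) {χ : ({x : α' // blk x ∈ W} → ℝ) → ℝ} (hχ : ContDiff ℝ ∞ χ)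
    (hs : HasCompactSupport χ) (M : ℕ) (obs : κ → List ({x : α' // blk x ∈ W} → ℝ)) (K : Finset κ) :
    (∫ φ, lmono (K.val.toList.flatMap obs) φ * (χ φ * vexp c legs φ) ∂(fieldLaw blk Δ ℱ W))
        / ∫ φ, χ φ * vexp c legs φ ∂(fieldLaw blk Δ ℱ W)
      = ∑ O ∈ K.powerset, ∑ π ∈ setPartitions (K \ O),
          (∏ Xc ∈ π, flBlock (prec blk Δ W (corner ℝ W)) (src blk ℱ W) c legs obs M Xc) *
            (((expand (prec blk Δ W (corner ℝ W)) (src blk ℱ W) c legs obs M 0 O).filter fun t => t.consts = 0).map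
              fun t => t.coef * ((∫ φ, lmono ((t.groups.map fun h => (h.pend : Multiset _)).sum.toList) φ
                * (dlist t.dirs χ φ * vexp c legs φ) ∂(fieldLaw blk Δ ℱ W)) / ∫ φ, χ φ * vexp c legs φ ∂(fieldLaw blk Δ ℱ W))).sum := by
  rw [resummation312_fieldLaw blk Δ ℱ W hPD c legs hχ hs M obs K, Finset.sum_div]
  refine Finset.sum_congr rfl fun O _ => ?_
  rw [Finset.sum_div]
  refine Finset.sum_congr rfl fun π _ => ?_
  rw [mul_div_assoc, div_eq_mul_inv, ← Multiset.sum_map_mul_right]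
  congr 2
  refine Multiset.map_congr rfl fun t _ => ?_
  rw [div_eq_mul_inv, mul_assoc]

end FieldLaw

end Literature.MathematicalPhysics.QuantumFieldTheory.BalabanImbrieJaffe1984to88.BIJ88Resummation312Display

end
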